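import Summits.PneNP.PneNP.Theorems.SymmetryBudgetNoHiddenOrderReplayIter

/-!
# `NoHiddenOrder` (stmt-PneNP-14781), (R2c) replay circuit II: the REPLAY module — stages and induction

Route `PneNP/SymmetryBudget`; continuation of `SymmetryBudgetNoHiddenOrderReplayIter.lean`.

* `ReplayIter.sem_ltW_last_iff`, `sem_eqW_last_iff` — the refinement module of a stage reads `refineIn` of
  the individualised colouring (`RefineIter.sem_ltW_iff/sem_eqW_iff` with fixed `T ≥ |A| - 1` rounds versus
  `|A|` rounds: `ocrIter_lt/eq_iff_of_card_le`);
* `ReplayIter.sem_memW_last_iff` — the atom module reads `atom` of the pointer (`AtomIter.memW_last_iff_atom`);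
* `ReplayIter.stateReads_succ` — ONE STAGE: the state wires of stage `k + 1` read `stepSt` of the state read
  at stage `k` (multiplexed by `go`);
* `ReplayIter.stateReads_replay`, `stateReads_replay'` — ALL STAGES: from a root state read at stage `0`
  (pointer inside, equitable inside its block, connected switching graph), the state wires of every stage
  `k ≤ F` read `BranchSum.replay G S hgt ptr k St₀`: its block, and the order and kernel of its colouring.
Sorry-free; supports stmt-PneNP-14781, does not close it.
-/

set_option linter.dupNamespace false -- `Summit.PneNP.PneNP.…` (D-0017 single-conjunct layout)

namespace Summit.PneNP.PneNP.Theorems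

open Finset Literature.Computability.Complexity Literature.Computability.Complexity.SymProg
open Literature.Combinatorics.SimpleGraph (ocrIter)

namespace ReplayIter

variable {ι Λ : Type*} [DecidableEq ι] [DecidableEq Λ] {P : SymProg ι Λ}
variable {V : Type*} [Fintype V] [DecidableEq V] {N T J F : ℕ}
variable {RP : ReplayIter P V N T J F} {x : ι → Bool}
variable {G : SimpleGraph V} [DecidableRel G.Adj]

section Stage2

variable {k : Fin F} {A : Finset V} {col : V → ℕ}

omit [Fintype V] [DecidableEq V] in
/-- `|A| ≤ |A|²`-type bookkeeping. [folklore] -/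
theorem card_le_of_sq_le (hN : A.card ^ 2 ≤ N) : A.card ≤ N :=
  le_trans (Nat.le_self_pow two_ne_zero _) hN

/-- The part of the stage-`k` refinement module is the block. [folklore] -/
theorem part_RI (hread : RP.StateReads x k.castSucc A col) : (RP.RI k).part x = A := by
  ext u; unfold RefineIter.part
  simp only [mem_filter, mem_univ, true_and, show (RP.RI k).mem = RP.memS k.castSucc from RP.RI_mem k]
  exact hread.mem_iff u

/-- The refinement module reads the individualised colouring of the block (under the step condition). [folklore] -/
theorem reads_RI (hadj : ∀ a b, wval x (P.sem x) (RP.adj a b) = true ↔ G.Adj a b)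
    (hread : RP.StateReads x k.castSucc A col) (hinv : 2 ≤ A.card → EqIn G A col ∧ ConnIn G A col)
    (hN : A.card ≤ N) (hc : StepCond RP.S RP.hgt (A, col)) :
    RefineIter.Reads₀ (RP.RI k) x (G.induce (((RP.RI k).part x : Finset V) : Set V))
      (fun a => BranchSum.indiv col (Finset.card_eq_one.1 hc.2).choose a) where
  adj_iff a b := by rw [show (RP.RI k).adj = RP.adj from RP.RI_adj k]; exact hadj a b
  lt0_iff a b := by
    rw [RP.RI_lt0, wval_inr]
    exact sem_ltI_iff hread hinv hN hc (part_RI hread ▸ a.2) (part_RI hread ▸ b.2)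
  eq0_iff a b := by
    rw [RP.RI_eq0, wval_inr]
    exact sem_eqI_iff hread hinv hN hc (part_RI hread ▸ a.2) (part_RI hread ▸ b.2)

omit [Fintype V] in
/-- Fixed rounds versus `|W|` rounds: order. [folklore] -/
theorem ocrIter_T_lt_iff_refineIn {W : Finset V} (f : V → ℕ) (hT : W.card ≤ T + 1) {a b : V} (ha : a ∈ W) (hb : b ∈ W) :
    ocrIter (G.induce (W : Set V)) (fun z : ↥(W : Set V) => f z) T ⟨a, mem_coe.2 ha⟩ <
        ocrIter (G.induce (W : Set V)) (fun z : ↥(W : Set V) => f z) T ⟨b, mem_coe.2 hb⟩ ↔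
      BranchSum.refineIn G W f a < BranchSum.refineIn G W f b := by
  have hcardW : Fintype.card (↥(W : Set V)) = W.card := by simp
  rw [BranchSum.refineIn_apply f ha, BranchSum.refineIn_apply f hb]
  exact Literature.Combinatorics.SimpleGraph.ocrIter_lt_iff_of_card_le _ (by omega) (by omega) _ _

omit [Fintype V] in
/-- Fixed rounds versus `|W|` rounds: kernel. [folklore] -/
theorem ocrIter_T_eq_iff_refineIn {W : Finset V} (f : V → ℕ) (hT : W.card ≤ T + 1) {a b : V} (ha : a ∈ W) (hb : b ∈ W) :
    ocrIter (G.induce (W : Set V)) (fun z : ↥(W : Set V) => f z) T ⟨a, mem_coe.2 ha⟩ =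
        ocrIter (G.induce (W : Set V)) (fun z : ↥(W : Set V) => f z) T ⟨b, mem_coe.2 hb⟩ ↔
      BranchSum.refineIn G W f a = BranchSum.refineIn G W f b := by
  have hcardW : Fintype.card (↥(W : Set V)) = W.card := by simp
  rw [BranchSum.refineIn_apply f ha, BranchSum.refineIn_apply f hb]
  exact Literature.Combinatorics.SimpleGraph.ocrIter_eq_iff_of_card_le _ (by omega) (by omega) _ _

/-- **The refined order wires read `refineIn`** of the individualised colouring, on the block. [folklore] -/
theorem sem_ltW_last_iff (hadj : ∀ a b, wval x (P.sem x) (RP.adj a b) = true ↔ G.Adj a b)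
    (hread : RP.StateReads x k.castSucc A col) (hinv : 2 ≤ A.card → EqIn G A col ∧ ConnIn G A col)
    (hN : A.card ≤ N) (hT : A.card ≤ T) (hc : StepCond RP.S RP.hgt (A, col)) {a b : V} (ha : a ∈ A) (hb : b ∈ A) :
    wval x (P.sem x) ((RP.RI k).ltW (Fin.last T) a b) = true ↔
      BranchSum.refineIn G A (BranchSum.indiv col (Finset.card_eq_one.1 hc.2).choose) a <
        BranchSum.refineIn G A (BranchSum.indiv col (Finset.card_eq_one.1 hc.2).choose) b := by
  have hpart := part_RI hread
  have key : ∀ (W : Finset V), W = A → ∀ (ha' : a ∈ W) (hb' : b ∈ W),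
      (ocrIter (G.induce (W : Set V)) (fun z : ↥(W : Set V) => BranchSum.indiv col (Finset.card_eq_one.1 hc.2).choose z)
          T ⟨a, mem_coe.2 ha'⟩ <
        ocrIter (G.induce (W : Set V)) (fun z : ↥(W : Set V) => BranchSum.indiv col (Finset.card_eq_one.1 hc.2).choose z)
          T ⟨b, mem_coe.2 hb'⟩ ↔
      BranchSum.refineIn G A (BranchSum.indiv col (Finset.card_eq_one.1 hc.2).choose) a <
        BranchSum.refineIn G A (BranchSum.indiv col (Finset.card_eq_one.1 hc.2).choose) b) := by
    rintro W rfl ha' hb'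
    exact ocrIter_T_lt_iff_refineIn _ (by omega) ha' hb'
  rw [← key ((RP.RI k).part x) hpart (hpart ▸ ha) (hpart ▸ hb)]
  exact RefineIter.sem_ltW_iff (reads_RI hadj hread hinv hN hc) (by rw [hpart]; exact hN) (Fin.last T)
    ⟨a, hpart ▸ ha⟩ ⟨b, hpart ▸ hb⟩

/-- **The refined kernel wires read `refineIn`** of the individualised colouring, on the block. [folklore] -/
theorem sem_eqW_last_iff (hadj : ∀ a b, wval x (P.sem x) (RP.adj a b) = true ↔ G.Adj a b)
    (hread : RP.StateReads x k.castSucc A col) (hinv : 2 ≤ A.card → EqIn G A col ∧ ConnIn G A col)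
    (hN : A.card ≤ N) (hT : A.card ≤ T) (hc : StepCond RP.S RP.hgt (A, col)) {a b : V} (ha : a ∈ A) (hb : b ∈ A) :
    wval x (P.sem x) ((RP.RI k).eqW (Fin.last T) a b) = true ↔
      BranchSum.refineIn G A (BranchSum.indiv col (Finset.card_eq_one.1 hc.2).choose) a =
        BranchSum.refineIn G A (BranchSum.indiv col (Finset.card_eq_one.1 hc.2).choose) b := by
  have hpart := part_RI hread
  have key : ∀ (W : Finset V), W = A → ∀ (ha' : a ∈ W) (hb' : b ∈ W),
      (ocrIter (G.induce (W : Set V)) (fun z : ↥(W : Set V) => BranchSum.indiv col (Finset.card_eq_one.1 hc.2).choose z)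
          T ⟨a, mem_coe.2 ha'⟩ =
        ocrIter (G.induce (W : Set V)) (fun z : ↥(W : Set V) => BranchSum.indiv col (Finset.card_eq_one.1 hc.2).choose z)
          T ⟨b, mem_coe.2 hb'⟩ ↔
      BranchSum.refineIn G A (BranchSum.indiv col (Finset.card_eq_one.1 hc.2).choose) a =
        BranchSum.refineIn G A (BranchSum.indiv col (Finset.card_eq_one.1 hc.2).choose) b) := by
    rintro W rfl ha' hb'
    exact ocrIter_T_eq_iff_refineIn _ (by omega) ha' hb'
  rw [← key ((RP.RI k).part x) hpart (hpart ▸ ha) (hpart ▸ hb)]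
  exact RefineIter.sem_eqW_iff (reads_RI hadj hread hinv hN hc) (by rw [hpart]; exact hN) (Fin.last T)
    ⟨a, hpart ▸ ha⟩ ⟨b, hpart ▸ hb⟩

/-- **The atom module's output reads the atom** of the pointer under the refined colouring. [folklore] -/
theorem sem_memW_last_iff (hadj : ∀ a b, wval x (P.sem x) (RP.adj a b) = true ↔ G.Adj a b)
    (hread : RP.StateReads x k.castSucc A col) (hinv : 2 ≤ A.card → EqIn G A col ∧ ConnIn G A col)
    (hN : A.card ^ 2 ≤ N) (hT : A.card ≤ T) (hJ : A.card + 1 ≤ J) (hc : StepCond RP.S RP.hgt (A, col)) (u : V) :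
    wval x (P.sem x) ((RP.AI k).memW (Fin.last J) u) = true ↔
      u ∈ BranchSum.atom G A (BranchSum.refineIn G A (BranchSum.indiv col (Finset.card_eq_one.1 hc.2).choose)) RP.ptr := by
  rw [← show (RP.AI k).ptr = RP.ptr from RP.AI_ptr k]
  refine AtomIter.memW_last_iff_atom (AI := RP.AI k) (fun a b => ?_) (fun a ha b hb => ?_) (fun w => ?_) hN hT hJ u
  · rw [show (RP.AI k).adj = RP.adj from RP.AI_adj k]; exact hadj a b
  · rw [RP.AI_eq]; exact sem_eqW_last_iff hadj hread hinv (card_le_of_sq_le hN) hT hc ha hb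
  · rw [show (RP.AI k).mem0 = RP.memS k.castSucc from RP.AI_mem0 k]; exact hread.mem_iff w

/-- A two-way multiplexer. [folklore] -/
theorem sem_mux {g ng m1 m2 mx : Λ} {wN wO : ι ⊕ Λ} (hm1k : P.kind m1 = Kind.and) (hm1s : P.srcs m1 = {Sum.inr g, wN})
    (hm2k : P.kind m2 = Kind.and) (hm2s : P.srcs m2 = {Sum.inr ng, wO}) (hmxk : P.kind mx = Kind.or)
    (hmxs : P.srcs mx = {Sum.inr m1, Sum.inr m2}) (hng : P.sem x ng = !(P.sem x g)) :
    P.sem x mx = (if P.sem x g then wval x (P.sem x) wN else wval x (P.sem x) wO) := by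
  have h1 : P.sem x m1 = (P.sem x g && wval x (P.sem x) wN) := by
    rw [Bool.eq_iff_iff, P.sem_and hm1k, hm1s]
    simp only [mem_insert, mem_singleton, forall_eq_or_imp, forall_eq, wval_inr, Bool.and_eq_true]
  have h2 : P.sem x m2 = (P.sem x ng && wval x (P.sem x) wO) := by
    rw [Bool.eq_iff_iff, P.sem_and hm2k, hm2s]
    simp only [mem_insert, mem_singleton, forall_eq_or_imp, forall_eq, wval_inr, Bool.and_eq_true]
  have h3 : P.sem x mx = (P.sem x m1 || P.sem x m2) := by
    rw [Bool.eq_iff_iff, P.sem_or hmxk, hmxs]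
    simp only [mem_insert, mem_singleton, exists_eq_or_imp, exists_eq_left, wval_inr, Bool.or_eq_true]
  rw [h3, h1, h2, hng]
  cases P.sem x g <;> simp

/-- **ONE STAGE**: the state wires of stage `k + 1` read `stepSt` of the state read at stage `k`. [folklore] -/
theorem stateReads_succ (hadj : ∀ a b, wval x (P.sem x) (RP.adj a b) = true ↔ G.Adj a b)
    (hread : RP.StateReads x k.castSucc A col)
    (hinv : 2 ≤ A.card → EqIn G A col ∧ ConnIn G A col)
    (hN : A.card ^ 2 ≤ N) (hT : A.card ≤ T) (hJ : A.card + 1 ≤ J) :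
    RP.StateReads x k.succ (stepSt G RP.S RP.hgt RP.ptr (A, col)).1 (stepSt G RP.S RP.hgt RP.ptr (A, col)).2 := by
  have hN1 := card_le_of_sq_le hN
  have hng : P.sem x (RP.ng k) = !(P.sem x (RP.go k)) := by
    rw [P.sem_nor_singleton (RP.kind_ng k) (RP.srcs_ng k), wval_inr]
  have hmem : ∀ u, P.sem x (RP.mxM k u) =
      (if P.sem x (RP.go k) then wval x (P.sem x) ((RP.AI k).memW (Fin.last J) u)
        else wval x (P.sem x) (RP.memS k.castSucc u)) := fun u =>
    sem_mux (RP.kind_m1M k u) (RP.srcs_m1M k u) (RP.kind_m2M k u) (RP.srcs_m2M k u) (RP.kind_mxM k u) (RP.srcs_mxM k u) hng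
  have hlt : ∀ u v, P.sem x (RP.mxL k u v) =
      (if P.sem x (RP.go k) then wval x (P.sem x) ((RP.RI k).ltW (Fin.last T) u v)
        else wval x (P.sem x) (RP.ltS k.castSucc u v)) := fun u v =>
    sem_mux (RP.kind_m1L k u v) (RP.srcs_m1L k u v) (RP.kind_m2L k u v) (RP.srcs_m2L k u v) (RP.kind_mxL k u v)
      (RP.srcs_mxL k u v) hng
  have heq : ∀ u v, P.sem x (RP.mxE k u v) =
      (if P.sem x (RP.go k) then wval x (P.sem x) ((RP.RI k).eqW (Fin.last T) u v)
        else wval x (P.sem x) (RP.eqS k.castSucc u v)) := fun u v =>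
    sem_mux (RP.kind_m1E k u v) (RP.srcs_m1E k u v) (RP.kind_m2E k u v) (RP.srcs_m2E k u v) (RP.kind_mxE k u v)
      (RP.srcs_mxE k u v) hng
  by_cases hc : StepCond RP.S RP.hgt (A, col)
  · have hgo : P.sem x (RP.go k) = true := (sem_go_iff hread hinv hN1).2 hc
    rw [stepSt_of_cond hc]
    show RP.StateReads x k.succ
      (BranchSum.atom G A (BranchSum.refineIn G A (BranchSum.indiv col (Finset.card_eq_one.1 hc.2).choose)) RP.ptr)
      (BranchSum.refineIn G A (BranchSum.indiv col (Finset.card_eq_one.1 hc.2).choose))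
    refine ⟨fun u => ?_, fun a ha b hb => ?_, fun a ha b hb => ?_⟩
    · rw [RP.memS_succ, wval_inr, hmem, if_pos hgo]
      exact sem_memW_last_iff hadj hread hinv hN hT hJ hc u
    · rw [RP.ltS_succ, wval_inr, hlt, if_pos hgo]
      exact sem_ltW_last_iff hadj hread hinv hN1 hT hc (BranchSum.atom_subset _ _ _ ha) (BranchSum.atom_subset _ _ _ hb)
    · rw [RP.eqS_succ, wval_inr, heq, if_pos hgo]
      exact sem_eqW_last_iff hadj hread hinv hN1 hT hc (BranchSum.atom_subset _ _ _ ha) (BranchSum.atom_subset _ _ _ hb)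
  · have hgo : P.sem x (RP.go k) = false := by
      rw [← Bool.not_eq_true, sem_go_iff hread hinv hN1]; exact hc
    rw [stepSt_of_not_cond hc]
    refine ⟨fun u => ?_, fun a ha b hb => ?_, fun a ha b hb => ?_⟩
    · rw [RP.memS_succ, wval_inr, hmem, hgo]; exact hread.mem_iff u
    · rw [RP.ltS_succ, wval_inr, hlt, hgo]; exact hread.lt_iff a ha b hb
    · rw [RP.eqS_succ, wval_inr, heq, hgo]; exact hread.eq_iff a ha b hb

end Stage2

/-! ### All stages: the state wires read the replay -/

/-- **The state wires of every stage `k ≤ F` read `BranchSum.replay … k` of the root state**, provided the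
root state is read at stage `0`, contains the pointer, and is equitable inside its block with connected
switching graph (when it has at least two vertices). [folklore] -/
theorem stateReads_replay (hadj : ∀ a b, wval x (P.sem x) (RP.adj a b) = true ↔ G.Adj a b)
    {A₀ : Finset V} {col₀ : V → ℕ} (h0 : RP.StateReads x 0 A₀ col₀) (hptr0 : RP.ptr ∈ A₀)
    (hinv0 : 2 ≤ A₀.card → EqIn G A₀ col₀ ∧ ConnIn G A₀ col₀)
    (hN : A₀.card ^ 2 ≤ N) (hT : A₀.card ≤ T) (hJ : A₀.card + 1 ≤ J) :
    ∀ (k : ℕ) (hk : k < F + 1),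
      RP.StateReads x ⟨k, hk⟩ (BranchSum.replay G RP.S RP.hgt RP.ptr k (A₀, col₀)).1
          (BranchSum.replay G RP.S RP.hgt RP.ptr k (A₀, col₀)).2 ∧
        RP.ptr ∈ (BranchSum.replay G RP.S RP.hgt RP.ptr k (A₀, col₀)).1 ∧
        (2 ≤ (BranchSum.replay G RP.S RP.hgt RP.ptr k (A₀, col₀)).1.card →
          EqIn G (BranchSum.replay G RP.S RP.hgt RP.ptr k (A₀, col₀)).1 (BranchSum.replay G RP.S RP.hgt RP.ptr k (A₀, col₀)).2 ∧
            ConnIn G (BranchSum.replay G RP.S RP.hgt RP.ptr k (A₀, col₀)).1 (BranchSum.replay G RP.S RP.hgt RP.ptr k (A₀, col₀)).2) ∧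
        (BranchSum.replay G RP.S RP.hgt RP.ptr k (A₀, col₀)).1 ⊆ A₀ := by
  intro k
  induction k with
  | zero => intro hk; exact ⟨h0, hptr0, hinv0, Subset.rfl⟩
  | succ k ih =>
    intro hk
    have hkF : k < F := Nat.lt_of_succ_lt_succ hk
    obtain ⟨hread, hptr, hinv, hsub⟩ := ih (Nat.lt_of_lt_of_le hkF (Nat.le_succ F))
    have hcard : (BranchSum.replay G RP.S RP.hgt RP.ptr k (A₀, col₀)).1.card ≤ A₀.card := card_le_card hsub
    rw [replay_succ_eq_stepSt]
    set St := BranchSum.replay G RP.S RP.hgt RP.ptr k (A₀, col₀) with hSt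
    have hcast : (⟨k + 1, hk⟩ : Fin (F + 1)) = (⟨k, hkF⟩ : Fin F).succ := rfl
    refine ⟨?_, ptr_mem_stepSt hptr, inv_stepSt' hptr hinv, (stepSt_fst_subset _).trans hsub⟩
    rw [hcast]
    exact stateReads_succ (k := ⟨k, hkF⟩) (A := St.1) (col := St.2) hadj hread hinv
      (le_trans (Nat.pow_le_pow_left hcard 2) hN) (hcard.trans hT) (by omega)

/-- The state wires of stage `k ≤ F` read the block and colouring of the replayed state. [folklore] -/
theorem stateReads_replay' (hadj : ∀ a b, wval x (P.sem x) (RP.adj a b) = true ↔ G.Adj a b)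
    {A₀ : Finset V} {col₀ : V → ℕ} (h0 : RP.StateReads x 0 A₀ col₀) (hptr0 : RP.ptr ∈ A₀)
    (hinv0 : 2 ≤ A₀.card → EqIn G A₀ col₀ ∧ ConnIn G A₀ col₀)
    (hN : A₀.card ^ 2 ≤ N) (hT : A₀.card ≤ T) (hJ : A₀.card + 1 ≤ J) (k : Fin (F + 1)) :
    RP.StateReads x k (BranchSum.replay G RP.S RP.hgt RP.ptr k (A₀, col₀)).1
      (BranchSum.replay G RP.S RP.hgt RP.ptr k (A₀, col₀)).2 :=
  (stateReads_replay hadj h0 hptr0 hinv0 hN hT hJ k k.2).1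

end ReplayIter

end Summit.PneNP.PneNP.Theorems
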